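import Summits.BirchSwinnertonDyer.BirchSwinnertonDyer.Theses.SignedBaseChange
import Literature.NumberTheory.EllipticCurves.TwoVariableAnticyclotomicControl
import Literature.NumberTheory.EllipticCurves.HeegnerPointsKolyvaginTorsionProofs
import Literature.NumberTheory.EllipticCurves.YanZhu2026.GreenbergMainTheoremsAnyRoot
import HarnessLib

/-!
# Stub S2c `stub_controlSurjSS` of line `bdpline` (v3) on the crux `AnticyclotomicEisensteinDivisibility`
# (stmt-BirchSwinnertonDyer-20727, route SignedBaseChange) — PROVED: the control surjection
# `X_Gr₂/T₁X_Gr₂ ↠ X_Gr(E/K_∞⁻) = X_ac`, `Λ₁`-linear for the constants structure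

Lead prover sbc-p1 g7 (2026-08-27). The registered stub (skeleton bdpline v3, sha16 bef29d8c5401ab17)
asks, under the crux telescope (good supersingular `p ≥ 5`, `Surj`, `K` imaginary quadratic of Heegner
type, `p = v v̄`, `(κ₁, κ₂; γ₁, γ₂)` a top-generator pair), for a SURJECTIVE `Λ₁ = ℤ_p⟦T⟧`-linear map
`X_Gr₂ / T₁ X_Gr₂ → X_ac`, where `X_Gr₂ = (W_K).XGr₂ p κ₁ κ₂ v̄ γ₁ γ₂` (dual of the Greenberg Selmer group
over the `ℤ_p²`-tower), `X_ac = Castella2018.AcSelmer.XAc W_K p κ₂ v̄ ∅ γ₂`, and the `Λ₁`-structure on the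
quotient `QuotSMulTop T₁ X_Gr₂` is the restriction along the constants `PowerSeries.C : Λ₁ → Λ₂`
(`Module.compHom`, written into the stub).

It is ASSEMBLED from the tree: the literature-prover file
`Literature/NumberTheory/EllipticCurves/TwoVariableAnticyclotomicControl.lean` (p561609, item wi-82197)
constructs `WeierstrassCurve.XGr₂.toXAcQuot : X_Gr₂ ⧸ (T₁)•X_Gr₂ →ₛₗ[constantCoeff] X_ac`, proves
`toXAcQuot_C_smul` (`C f` acts as `f`) and `toXAcQuot_surjective` under `E(K)[p] = 0`
(inflation–restriction, `E(K̃_∞)[p^∞] = 0` from the pro-`p` fixed-point principle, Pontryagin duality);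
`E(K)[p] = 0` for `K` imaginary quadratic is `torsionBy_eq_bot_of_isImaginaryQuadratic` (Gross 1991 §2,
from `Surj` and `p ≠ 2`). The only work here is repackaging the semilinear map on
`X_Gr₂ ⧸ (Ideal.span {T₁} • ⊤)` as a `Λ₁`-LINEAR map on `QuotSMulTop T₁ X_Gr₂ = X_Gr₂ ⧸ T₁ • ⊤`
(`Submodule.ideal_span_singleton_smul`, `Submodule.quotEquivOfEq`) for the `Module.compHom _ C` structure.
Most crux hypotheses are idle here (only `Surj`, `5 ≤ p`, `IsImaginaryQuadratic K` and the generator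
pair are used). Nothing about BSD is asserted.
-/

-- D-0017: single-problem summit, the namespace repeats the problem name by design.
set_option linter.dupNamespace false
set_option autoImplicit false

noncomputable section

open scoped Classical

namespace Summit.BirchSwinnertonDyer.BirchSwinnertonDyer.Theorems.SignedBaseChangeAcDivControl

open Summit.BirchSwinnertonDyer.BirchSwinnertonDyer.Theses.SignedBaseChange
open Literature.NumberTheory.EllipticCurves

/-- **Stub S2c of line `bdpline` (v3), PROVED: control `X_Gr₂/T₁X_Gr₂ ↠ X_ac`.** Under the crux
telescope there is a surjective `Λ₁`-linear map `QuotSMulTop T₁ X_Gr₂ → X_ac` for the constants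
`Λ₁`-structure — the quotient control map `WeierstrassCurve.XGr₂.toXAcQuot` of
`TwoVariableAnticyclotomicControl` (semilinear over `T₁ ↦ 0`, `C f ↦ f`), transported to
`X_Gr₂ ⧸ T₁ • ⊤`, surjective because `E(K)[p] = 0` (`torsionBy_eq_bot_of_isImaginaryQuadratic`,
`Surj`, `p ≥ 5`). [cite: SkinnerUrban2014, §3.2.7 and Prop. 3.2.8 (p. 23)]
[cite: GreenbergLNM1716, §3 Lemma 3.1] [cite: GrossLMS1991, §2 (after (2.2))] -/
theorem stub_controlSurjSS :
    SignedTwoVariableInputs → Literature.NumberTheory.EllipticCurves.ModularForms.nonempty_modularParametrizationData → ∀ (W : WeierstrassCurve ℚ) [W.IsElliptic] [W.IsGloballyMinimal] (p : ℕ) [Fact p.Prime], 5 ≤ p → W.HasGoodReductionAtPrime p → W.frobeniusTrace p = 0 → Literature.NumberTheory.EllipticCurves.Rank1Residual.Surj W p → ∀ (K : Type) [Field K] [NumberField K] (ι : PadicAlgCl p ≃+* ℂ) (v vbar : IsDedekindDomain.HeightOneSpectrum (NumberField.RingOfIntegers K)) (κ₁ κ₂ : Literature.NumberTheory.EllipticCurves.ZpExtension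 K p) (γ₁ γ₂ : Field.absoluteGaloisGroup K) [Fact (Literature.NumberTheory.EllipticCurves.ZpExtension.IsTopGeneratorPair κ₁ κ₂ γ₁ γ₂)] [NeZero (NumberField.discr K).natAbs] (N : ℕ) [NeZero N] (f : CuspForm (CongruenceSubgroup.Gamma0 N) 2), Literature.NumberTheory.EllipticCurves.ModularForms.IsNewformOf W f → (N : ℤ) = W.conductorNorm ℤ → Literature.NumberTheory.EllipticCurves.IsImaginaryQuadratic K → ((Ideal.span {(p : ℤ)}).primesOver (NumberField.RingOfIntegers K)).ncard = 2 → ((p : ℕ) : NumberField.RingOfIntegers K) ∈ v.asIdeal → ((p : ℕ) : NumberField.RingOfIntegers K) ∈ vbar.asIdeal → vbar ≠ v → (∀ (w : NumberField.InfinitePlace K) (k : NumberField.RingOfIntegers K), k ∈ v.asIdeal ↔ ‖ι.symm (w.embedding (k : K))‖ < 1) → IsCoprime (N : ℤ) (NumberField.discr K) → (∀ ℓ : ℕ, ℓ.Prime → ℓ ∣ N → ((Ideal.span {(ℓ : ℤ)}).primesOver (NumberField.RingOfIntegers K)).ncard = 2) → Odd (NumberField.discr K) → NumberField.discr K ≠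 -3 → κ₁.IsCyclotomic → κ₂.IsAnticyclotomic → (letI : Module (Literature.NumberTheory.EllipticCurves.IwasawaAlgebra p) (QuotSMulTop (PowerSeries.X : Literature.NumberTheory.EllipticCurves.IwasawaAlgebra₂ p) ((W.baseChange K).XGr₂ p κ₁ κ₂ vbar γ₁ γ₂)) := Module.compHom _ (PowerSeries.C (R := Literature.NumberTheory.EllipticCurves.IwasawaAlgebra p)); haveI : Fact (κ₂.IsTopGenerator γ₂) := ⟨Literature.NumberTheory.EllipticCurves.YanZhu2026.isTopGenerator_of_pair (κ₁ := κ₁) (γ₁ := γ₁)⟩; ∃ f : QuotSMulTop (PowerSeries.X : Literature.NumberTheory.EllipticCurves.IwasawaAlgebra₂ p) ((W.baseChange K).XGr₂ p κ₁ κ₂ vbar γ₁ γ₂) →ₗ[Literature.NumberTheory.EllipticCurves.IwasawaAlgebra p] Literature.NumberTheory.EllipticCurves.Castella2018.AcSelmer.XAc (W.baseChange K) p κ₂ vbar ∅ γ₂, Function.Surjective f) := by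
  intro _ _ W _ _ p _ hp _ _ hs K _ _ ι v vbar κ₁ κ₂ γ₁ γ₂ _ _ N _ f _ _ hK _ _ _ _ _ _ _ _ _ _ _
  haveI hγ₂ : Fact (κ₂.IsTopGenerator γ₂) :=
    ⟨Literature.NumberTheory.EllipticCurves.YanZhu2026.isTopGenerator_of_pair (κ₁ := κ₁) (γ₁ := γ₁)⟩
  -- `E(K)[p] = 0` from `Surj`, `p ≠ 2`, `K` imaginary quadratic
  have hp2 : p ≠ 2 := by omega
  have htor := torsionBy_eq_bot_of_isImaginaryQuadratic W K hK (Fact.out) hp2 hs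
  have hKp : ∀ P : (W.baseChange K).toAffine.Point, p • P = 0 → P = 0 := fun P hP => by
    have hmem : P ∈ AddSubgroup.torsionBy (W.baseChange K).toAffine.Point (p : ℤ) :=
      AddSubgroup.torsionBy.nsmul_iff.mpr hP
    rw [htor] at hmem
    exact AddSubgroup.mem_bot.mp hmem
  -- `X_Gr₂ ⧸ T₁ • ⊤ ≃ X_Gr₂ ⧸ (T₁) • ⊤`, then the tree's semilinear control map
  let e : QuotSMulTop (PowerSeries.X : IwasawaAlgebra₂ p) ((W.baseChange K).XGr₂ p κ₁ κ₂ vbar γ₁ γ₂)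
      ≃ₗ[IwasawaAlgebra₂ p] ((W.baseChange K).XGr₂ p κ₁ κ₂ vbar γ₁ γ₂ ⧸
        (Ideal.span {(PowerSeries.X : IwasawaAlgebra₂ p)} •
          (⊤ : Submodule (IwasawaAlgebra₂ p) ((W.baseChange K).XGr₂ p κ₁ κ₂ vbar γ₁ γ₂)))) :=
    Submodule.quotEquivOfEq _ _
      (Submodule.ideal_span_singleton_smul (PowerSeries.X : IwasawaAlgebra₂ p) ⊤).symm
  let ψ := (WeierstrassCurve.XGr₂.toXAcQuot (W.baseChange K) p κ₁ κ₂ vbar γ₁ γ₂).comp e.toLinearMap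
  have hψ : Function.Surjective ψ :=
    (WeierstrassCurve.XGr₂.toXAcQuot_surjective (W.baseChange K) p κ₁ κ₂ vbar γ₁ γ₂ hKp).comp
      e.surjective
  letI : Module (IwasawaAlgebra p)
      (QuotSMulTop (PowerSeries.X : IwasawaAlgebra₂ p) ((W.baseChange K).XGr₂ p κ₁ κ₂ vbar γ₁ γ₂)) :=
    Module.compHom _ (PowerSeries.C (R := IwasawaAlgebra p))
  refine ⟨{ toFun := ψ
            map_add' := ψ.map_add
            map_smul' := fun a q => ?_ }, hψ⟩
  show ψ ((PowerSeries.C a : IwasawaAlgebra₂ p) • q) = a • ψ q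
  rw [ψ.map_smulₛₗ, PowerSeries.constantCoeff_C]

end Summit.BirchSwinnertonDyer.BirchSwinnertonDyer.Theorems.SignedBaseChangeAcDivControl

end
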